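import Mathlib.LinearAlgebra.RootSystem.Base
import Mathlib.Algebra.Lie.Subalgebra
import HarnessLib

/-!
# Chevalley systems: the infinitesimal data of the derived group of a split reductive group

Trunk T-AUTOMORPHIC (G25 AutomorphicL); interface between the Lie-algebra construction
(`ChevalleySystem.lean`: the semisimple Lie algebra of a reduced root datum with root vectors,
from Mathlib's Geck construction) and the highest-weight theory / group construction of
Chevalley's existence theorem (`Literature.NumberTheory.Automorphic.chevalley_existence`,
Springer, *Linear Algebraic Groups*, 2nd ed., 10.1.1). For a root datum `P` over `ℤ` with base
`b`, a **Chevalley system** over `k` in a Lie algebra `L` consists of Cartan elements `h_s`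
(`s` simple) and root vectors `e_α` (`α ∈ Φ`) with `[h_s, h_t] = 0`,
`[h_s, e_α] = ⟨α, α_s^∨⟩ e_α`, `[e_α, e_{-α}] = h_α := ∑_s c_{α s} h_s` where
`α^∨ = ∑_s c_{α s} α_s^∨` (`corootCoord`), `[e_α, e_β] ∈ kˣ e_{α+β}` (a *non-zero* multiple) if
`α + β ∈ Φ` and `= 0` if `α + β ∉ Φ ∪ {0}`, such that `(h_s, e_α)` is a basis of `L` and `L` is
generated by the `h_s` and the `e_{±α_s}` (`IsChevalleySystem`). This is weaker than Bourbaki's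
*système de Chevalley* (*Lie* VIII §2.4 Déf. 3: no sign normalisation, no involution; compare
Mathlib's `LieAlgebra.Basis`, which records the simple generators only); it is meant for
*reduced* root data (for a non-reduced pairing the non-vanishing clause at `β = α` makes the
notion empty) and the non-vanishing of the constants is a characteristic-`0` (or `p > 3`)
phenomenon (`N_{α,β} = ±(r+1)`, Humphreys §25.2), matching the `CharZero k` of the consumer
`chevalley_existence`. With Cartan elements indexed by the simple roots the system describes the
Lie algebra of the *derived* group; the torus part is supplied by `WeightTorus.lean`. This file:
the integer coordinates `corootCoord` of coroots in simple coroots (proved: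
`sum_corootCoord_smul`) and the definition. [folklore]
-/

noncomputable section

open Set Function

namespace Literature.NumberTheory.Automorphic

variable {ι X Y : Type*} [AddCommGroup X] [AddCommGroup Y] (P : RootPairing ι ℤ X Y) (b : P.Base)

/-! ### Integer coordinates of coroots in the simple coroots -/

/-- Every coroot lies in the `ℤ`-span of the simple coroots. [folklore] -/
lemma coroot_mem_span_simple (i : ι) :
    P.coroot i ∈ Submodule.span ℤ (range fun s : b.support => P.coroot (s : ι)) := by
  have hsub : (AddSubmonoid.closure (P.coroot '' b.support) : Set Y) ⊆
      Submodule.span ℤ (range fun s : b.support => P.coroot (s : ι)) := by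
    intro y hy
    induction hy using AddSubmonoid.closure_induction with
    | mem y hy =>
      obtain ⟨s, hs, rfl⟩ := hy
      exact Submodule.subset_span ⟨⟨s, hs⟩, rfl⟩
    | zero => exact Submodule.zero_mem _
    | add y y' _ _ h h' => exact Submodule.add_mem _ h h'
  rcases b.coroot_mem_or_neg_mem i with h | h
  · exact hsub h
  · exact (Submodule.neg_mem_iff _).1 (hsub h)

/-- The simple coroots are linearly independent (as a family over the support). [folklore] -/
lemma linearIndependent_coroot_support : LinearIndependent ℤ fun s : b.support => P.coroot (s : ι) :=
  b.linearIndepOn_coroot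

/-- **The integer coordinates `c_{α s}` of the coroot `α^∨` in the simple coroots `α_s^∨`.**
[folklore] -/
def corootCoord (i : ι) : b.support →₀ ℤ :=
  (linearIndependent_coroot_support P b).repr ⟨P.coroot i, coroot_mem_span_simple P b i⟩

/-- **`α_i^∨ = ∑_s c_{i s} α_s^∨`** (finite support). [folklore] -/
theorem sum_corootCoord_smul (i : ι) :
    ∑ s : b.support, corootCoord P b i s • P.coroot (s : ι) = P.coroot i := by
  have h := (linearIndependent_coroot_support P b).linearCombination_repr
    ⟨P.coroot i, coroot_mem_span_simple P b i⟩
  rw [Finsupp.linearCombination_apply, Finsupp.sum] at h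
  change ∑ s ∈ (corootCoord P b i).support, corootCoord P b i s • P.coroot (s : ι) = P.coroot i at h
  rw [← h]
  symm
  apply Finset.sum_subset (Finset.subset_univ _)
  intro s _ hs
  rw [Finsupp.notMem_support_iff.1 hs, zero_smul]

/-- The pairing with a coroot is the integer combination of the pairings with the simple coroots.
[folklore] -/
theorem toLinearMap_coroot_eq_sum (x : X) (i : ι) :
    P.toLinearMap x (P.coroot i) = ∑ s : b.support, corootCoord P b i s * P.toLinearMap x (P.coroot (s : ι)) := by
  conv_lhs => rw [← sum_corootCoord_smul P b i]
  rw [map_sum]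
  refine Finset.sum_congr rfl fun s _ => ?_
  rw [map_zsmul, smul_eq_mul]

/-! ### Chevalley systems -/

/-- **A Chevalley system for the based root datum `(P, b)` over `k` in the Lie algebra `L`**:
Cartan elements `h_s` (`s` simple) and root vectors `e_α` (all roots) with the relations
`[h_s, h_t] = 0`, `[h_s, e_α] = ⟨α, α_s^∨⟩ e_α`, `[e_α, e_{-α}] = ∑_s c_{α s} h_s`
(`= h_α`, `α^∨ = ∑ c_{α s} α_s^∨`), `[e_α, e_β] ∈ kˣ e_{α+β}` (a non-zero multiple) for
`α + β ∈ Φ`, `[e_α, e_β] = 0` for `α + β ∉ Φ ∪ {0}`; `(h_s, e_α)` is a basis of `L`; and the `e_α`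
lie in the Lie subalgebra generated by the `h_s` and the `e_{±α_s}` (Humphreys §8.4, §25.2;
Bourbaki *Lie* VIII §2.2, §4.2). No normalisation of the structure constants (no "Chevalley
basis" signs, no involution — weaker than Bourbaki's *système de Chevalley*) is required. Meant
for *reduced* root data (for non-reduced pairings the non-vanishing clause at `β = α` makes it
empty) and used with `CharZero k` (in characteristic `2`, `3` the constants `N_{α,β} = ±(r+1)`
may vanish for multiply-laced types, so the non-vanishing clause has no Chevalley-algebra model
there). [folklore] -/
structure IsChevalleySystem (k : Type*) [Field k] {L : Type*} [LieRing L] [LieAlgebra k L]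
    (h : b.support → L) (e : ι → L) : Prop where
  /-- The Cartan elements commute. -/
  lie_h_h : ∀ s t, ⁅h s, h t⁆ = 0
  /-- `e_α` has weight `α`: `[h_s, e_α] = ⟨α, α_s^∨⟩ e_α`. -/
  lie_h_e : ∀ s i, ⁅h s, e i⁆ = (P.pairing i s : k) • e i
  /-- `[e_α, e_{-α}] = h_α = ∑_s c_{α s} h_s`. -/
  lie_e_neg : ∀ i, ⁅e i, e (P.reflectionPerm i i)⁆ = ∑ s, (corootCoord P b i s : k) • h s
  /-- `[e_α, e_β]` is a *non-zero* multiple of `e_{α+β}` when `α + β` is a root. -/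
  exists_lie_e_e_eq_smul : ∀ i j l, P.root i + P.root j = P.root l →
    ∃ t : k, t ≠ 0 ∧ ⁅e i, e j⁆ = t • e l
  /-- `[e_α, e_β] = 0` when `α + β` is neither `0` nor a root. -/
  lie_e_e_eq_zero : ∀ i j, P.root i + P.root j ≠ 0 → P.root i + P.root j ∉ range P.root →
    ⁅e i, e j⁆ = 0
  /-- `(h_s, e_α)` is linearly independent ... -/
  linearIndependent : LinearIndependent k (Sum.elim h e)
  /-- ... and spans `L`. -/
  span_eq_top : Submodule.span k (range (Sum.elim h e)) = ⊤
  /-- Every `e_α` lies in the Lie subalgebra generated by the `h_s` and the `e_{±α_s}`. -/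
  e_mem_lieSpan : ∀ i, e i ∈ LieSubalgebra.lieSpan k L
    (range h ∪ ⋃ s : b.support, {e s, e (P.reflectionPerm s s)})

namespace IsChevalleySystem

variable {P b} {k : Type*} [Field k] {L : Type*} [LieRing L] [LieAlgebra k L]
  {h : b.support → L} {e : ι → L} (S : IsChevalleySystem P b k h e)
include S

/-- **The basis `(h_s, e_α)` of `L`.** [folklore] -/
def basis : Module.Basis (b.support ⊕ ι) k L := Module.Basis.mk S.linearIndependent S.span_eq_top.ge

/-- The vectors of the basis. [folklore] -/
@[simp] lemma coe_basis : ⇑S.basis = Sum.elim h e := Module.Basis.coe_mk _ _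

/-- The root vectors are non-zero. [folklore] -/
lemma e_ne_zero (i : ι) : e i ≠ 0 := by
  have := S.linearIndependent.ne_zero (Sum.inr i)
  simpa using this

/-- `L` is finite-dimensional (when there are finitely many roots). [folklore] -/
lemma finiteDimensional [Finite ι] : FiniteDimensional k L :=
  Module.Basis.finiteDimensional_of_finite S.basis

end IsChevalleySystem

end Literature.NumberTheory.Automorphic
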